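import Literature.Algebra.EuclideanLattices.MRFineGrid
import Literature.Algebra.EuclideanLattices.MRCombiningQuery
import Literature.Algebra.EuclideanLattices.GaussianSublatticeUniformity
import Literature.Algebra.EuclideanLattices.MRIncGDDSuccessPMF
import Literature.Computability.Cryptography.IncGDDToSISAnalysis
import Literature.Probability.Distributions.IndepProductLawKernels
import HarnessLib

/-!
# The idealised `IncGDD → SIS` reduction of Micciancio–Regev 2007 (Thm. 5.9) on the fine grid, and its success probability — proved

Topic `Algebra/EuclideanLattices` (family `pqc`). The whole of MR07 Thm. 5.9 (authors' version
pp. 22–24) EXCEPT the machine: the reduction is written as one `PMF` experiment over the fine grid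
`L' = L(S)/M` of `MRFineGrid.lean` (sampling procedure of Lemma 5.7 on the grid —
`GaussianSublatticeUniformity.lean`; combining procedure of Lemma 5.8 on the grid —
`MRFineGrid.lean`, `MRCombiningQuery.lean`; an arbitrary oracle kernel `O` on `ℤ_q^{n×m}`), and its
success probability is bounded below exactly as printed, by composing the bricks of the tree:

  `Pr[s ∈ L ∧ ‖s − t‖ ≤ n√m β σ/q + r] ≥ (δ_{j,α} − m · 2ε/(1+ε)) / 3`

(`toReal_experiment_success_ge`; `δ_{j,α} = Pr_{A ∼ U, z ∼ O(A)}[A z ≡ 0, ‖z‖ ≤ β, z_j = α]`; the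
printed `εm/2` of eq. (13) is `m · 2ε/(1+ε)` on the grid, immaterial since `ε` is negligible). What a
bit-level proof of Cor. 5.13 / Thm. 5.23 must add is only that the machine's output law is (close to)
this experiment in sampling order (`experiment_eq_samplingOrder`), plus the loop of Lemma 5.10
(`MRShortVectorsIteration.lean`, `KernelIteration.lean`) and amplification (`FirstSuccessBlocks.lean`).
Serves the named facts `Literature.Computability.Cryptography.MicciancioRegev2007_gapCVP'_to_SIS'`
and `Literature.Computability.Cryptography.owfExist_of_gapSVP_worstCaseHard` (machine-level Cor. 5.13).

## Objects (definitions with bodies; `b` the fine-grid basis, `sⱼ = M bⱼ ∈ L ⊆ span_ℤ b`, `M = q d`,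
## `rep` representatives of the offset classes `Q = (ℤ/Mℤ)ⁿ ⧸ H`, `H = L/L(S)`)

* `offsetLaw` — law of the class `c̄ᵢ` of run `i` of the sampling procedure (`r ∼ D_{L',s,tᵢ}`);
* `condLaw` — the conditional product law `⨂ᵢ D_{L,s,tᵢ+ĉᵢ}` of `Y` given the classes;
* `queryMatrix`, `combineOutput` — the query `A` and the output `x` of the combining procedure
  (`w̄ᵢ = gridCoord ĉᵢ + hᵢ`, `aᵢⱼ = ⌊val(w̄ᵢⱼ)/d⌋`, `x = ∑ zᵢ(cᵢ − wᵢ) + q⁻¹∑ⱼ(∑ᵢ zᵢaᵢⱼ) sⱼ`);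
* `experiment` — the joint law of `(((c̄, h), (A, z)), y)`; `output` — `s = x − Y z`.

## Results

* `bind_pure_queryMatrix_eq`, `tvDist_query_le` — the law of `A` is the product-of-columns law of
  `MRCombiningQuery`, hence within `m · 2ε/(1+ε)` of uniform (eq. (13) + Lemma 5.8 (i), via Lemma 5.7
  first claim `tvDist_gridSample_fst_le`);
* `cond_success_ge` — conditioned on the first stage and a good answer for the true query, success
  has probability `≥ 1/3` (Lemma 5.8 (ii)–(iii) on the grid + `MRIncGDDSuccessPMF`);
* `toReal_experiment_success_ge` — the printed bound, by `PMF.mul_sub_tvDist_le_toReal_experiment`;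
* `indepLaw_map_gridSample_eq`, `experiment_eq_samplingOrder` — the experiment equals the law of the
  reduction run in sampling order (Lemma 5.7 second claim, disintegration, stage swap).

## References

* D. Micciancio, O. Regev, *Worst-case to average-case reductions based on Gaussian measures*,
  SIAM J. Comput. 37 (2007) 267–302; authors' version (`lit read doi:10.1137/S0097539705447360`),
  Thm. 5.9 and its proof (pp. 22–24, Figure 2), Lemmas 5.7–5.8 (pp. 20–21), the grid convention (p. 8).
-/

noncomputable section

open Finset Module Submodule

namespace Literature.Algebra.EuclideanLattices

namespace MicciancioRegev2007

/-! ## The idealised `IncGDD → SIS` reduction of MR07 Thm. 5.9 on the fine grid (PMF level) -/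

section Idealised

open scoped ENNReal Classical Real
open MeasureTheory PMF Literature.Probability.Distributions

variable {V : Type*} [NormedAddCommGroup V] [InnerProductSpace ℝ V] [FiniteDimensional ℝ V]
  [MeasurableSpace V] [BorelSpace V]
variable {n : ℕ} (b : Basis (Fin n) ℝ V) (q d : ℕ) [NeZero q] [NeZero d]
variable (L : Submodule ℤ V) [DiscreteTopology L] [IsZLattice ℝ L]
variable (rep : (Fin n → ZMod (q * d)) ⧸ gridImage b (q * d) L → span ℤ (Set.range b))
variable {m : ℕ}

/-- **The law of the offset class `c̄ᵢ`** of the `i`-th run of the sampling procedure (Lemma 5.7 on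
the grid `L' = span_ℤ b`, noise `r ∼ D_{L',s,tᵢ}`, class map `gridClass` with kernel `L`): the first
marginal of `gridSample`. [cite: MicciancioRegev2007, Thm. 5.9 (proof, step 2) with Lemma 5.7] -/
def offsetLaw (hSL : ∀ j, ((q * d : ℕ) : ℝ) • b j ∈ L) (hrep : ∀ a, gridClass b (q * d) L (rep a) = a)
    (s : ℝ) (tvi : V) : PMF ((Fin n → ZMod (q * d)) ⧸ gridImage b (q * d) L) :=
  ((discreteGaussian (span ℤ (Set.range b)) s tvi).map
    (gridSample (gridClass b (q * d) L) (gridClass_eq_zero_iff b (q * d) L hSL) rep hrep)).map Prod.fst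

/-- **The conditional law of the lattice vectors `Y` given the classes**: independent
`yᵢ ∼ D_{L,s,tᵢ + ĉᵢ}`, `ĉᵢ = rep c̄ᵢ` (Lemma 5.7, second claim).
[cite: MicciancioRegev2007, Thm. 5.9 (proof, p. 23: "the vectors yᵢ are distributed independently according to D_{L(B),s,(cᵢ+tᵢ)}")] -/
def condLaw (s : ℝ) (tv : Fin m → V) (cbar : Fin m → (Fin n → ZMod (q * d)) ⧸ gridImage b (q * d) L) :
    PMF (Fin m → L) :=
  indepLaw m fun i => discreteGaussian L s (tv i + (rep (cbar i) : V))

/-- **The query matrix** `A = [a₁, …, a_m] ∈ ℤ_q^{n×m}` of the combining procedure on the grid: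
`w̄ᵢ = gridCoord (rep c̄ᵢ) + hᵢ` (`hᵢ` the uniform lattice class, "`vᵢ ∈ L(B) mod P(S)`") and
`aᵢⱼ = ⌊val(w̄ᵢⱼ)/d⌋ mod q` (`= ⌊q S⁻¹ wᵢ⌋ⱼ`), in the `Matrix (Fin n) (Fin m)` convention of
`SIS.successProb`. [cite: MicciancioRegev2007, Lemma 5.8 (steps 2–3 of A_F, p. 21)] -/
def queryMatrix (cbar : Fin m → (Fin n → ZMod (q * d)) ⧸ gridImage b (q * d) L)
    (hv : Fin m → (QuotientAddGroup.mk' (gridImage b (q * d) L)).ker) :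
    Matrix (Fin n) (Fin m) (ZMod q) :=
  Matrix.of fun j i =>
    ((((gridCoord b (q * d) (rep (cbar i)) + (hv i : Fin n → ZMod (q * d))) j).val / d : ℕ) : ZMod q)

/-- **The output `x` of the combining procedure** on the grid:
`x = ∑ᵢ zᵢ (cᵢ − wᵢ) + q⁻¹ ∑ⱼ (∑ᵢ zᵢ aᵢⱼ) • sⱼ` with `cᵢ = rep c̄ᵢ`, `wᵢ = gridRep w̄ᵢ`, `sⱼ = M bⱼ`.
[cite: MicciancioRegev2007, Lemma 5.8 (step 5 of A_F, p. 21)] -/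
def combineOutput (cbar : Fin m → (Fin n → ZMod (q * d)) ⧸ gridImage b (q * d) L)
    (hv : Fin m → (QuotientAddGroup.mk' (gridImage b (q * d) L)).ker) (z : Fin m → ℤ) : V :=
  ∑ i, (z i : ℝ) • ((rep (cbar i) : V) -
      (gridRep b (q * d) (gridCoord b (q * d) (rep (cbar i)) + (hv i : Fin n → ZMod (q * d))) : V)) +
    (q : ℝ)⁻¹ • ∑ j, ((∑ i, z i *
      ((((gridCoord b (q * d) (rep (cbar i)) + (hv i : Fin n → ZMod (q * d))) j).val / d : ℕ) : ℤ) : ℤ) : ℝ) •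
        (((q * d : ℕ) : ℝ) • b j)

/-- **The idealised reduction of MR07 Thm. 5.9 as one random experiment** (for a fixed guess, i.e.
fixed shifts `tᵢ`), with values `(((c̄, h), (A, z)), y)`: classes `c̄ᵢ ∼ offsetLaw` independently and
independent uniform lattice classes `hᵢ` (the first stage), then — conditionally independent given
the first stage — the lattice vectors `y ∼ condLaw c̄` and the pair (query `A = queryMatrix c̄ h`,
answer `z ∼ O(A)`) for an arbitrary oracle kernel `O`. Written in the shape of
`PMF.mul_sub_tvDist_le_toReal_experiment`. [cite: MicciancioRegev2007, Thm. 5.9 (proof, pp. 22–23 and Figure 2)] -/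
def experiment (hSL : ∀ j, ((q * d : ℕ) : ℝ) • b j ∈ L) (hrep : ∀ a, gridClass b (q * d) L (rep a) = a)
    (O : Matrix (Fin n) (Fin m) (ZMod q) → PMF (Fin m → ℤ)) (s : ℝ) (tv : Fin m → V) :
    PMF ((((Fin m → (Fin n → ZMod (q * d)) ⧸ gridImage b (q * d) L) ×
        (Fin m → (QuotientAddGroup.mk' (gridImage b (q * d) L)).ker)) ×
        (Matrix (Fin n) (Fin m) (ZMod q) × (Fin m → ℤ))) × (Fin m → L)) :=
  (((indepLaw m fun i => offsetLaw b q d L rep hSL hrep s (tv i)).bind fun cbar =>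
      (PMF.uniformOfFintype (Fin m → (QuotientAddGroup.mk' (gridImage b (q * d) L)).ker)).map
        (Prod.mk cbar)).bind fun ch =>
    (condLaw b q d L rep s tv ch.1).bind fun y =>
      ((PMF.pure (queryMatrix b q d L rep ch.1 ch.2)).bind fun A => (O A).map (Prod.mk A)).map
        fun az => ((ch, az), y))

/-- **The output `s = x − Y z`** of the idealised reduction, read off a value of `experiment`.
[cite: MicciancioRegev2007, Thm. 5.9 (proof, step 4: "output the vector s = x − Yz")] -/
def output (ω : (((Fin m → (Fin n → ZMod (q * d)) ⧸ gridImage b (q * d) L) ×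
        (Fin m → (QuotientAddGroup.mk' (gridImage b (q * d) L)).ker)) ×
        (Matrix (Fin n) (Fin m) (ZMod q) × (Fin m → ℤ))) × (Fin m → L)) : V :=
  combineOutput b q d L rep ω.1.1.1 ω.1.1.2 ω.1.2.2 - ∑ i, (ω.1.2.2 i : ℝ) • ((ω.2 i : L) : V)

/-! ### The law of the query and its distance from uniform (Lemma 5.8 (i) with eq. (13)) -/

omit [FiniteDimensional ℝ V] [MeasurableSpace V] [BorelSpace V] [NeZero q] [NeZero d] [DiscreteTopology L]
  [IsZLattice ℝ L] in
/-- The representatives `gridCoord ∘ rep` are a section of the quotient map `ψ = mk' H`. [folklore] -/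
theorem mk'_gridCoord_rep (hrep : ∀ a, gridClass b (q * d) L (rep a) = a)
    (a : (Fin n → ZMod (q * d)) ⧸ gridImage b (q * d) L) :
    QuotientAddGroup.mk' (gridImage b (q * d) L) (gridCoord b (q * d) (rep a)) = a := by
  rw [← gridClass_apply]; exact hrep a

omit [MeasurableSpace V] [BorelSpace V] [DiscreteTopology L] [IsZLattice ℝ L] in
/-- **The law of the query `A` in the idealised experiment** is the product-of-columns law of
`MRCombiningQuery.tvDist_indepLaw_query_matrix_le` (offset laws `offsetLaw`, representatives
`gridCoord ∘ rep`, `ψ = mk' H`), transposed into the matrix convention. [cite: MicciancioRegev2007, Lemma 5.8 (i) (p. 21)] -/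
theorem bind_pure_queryMatrix_eq (hSL : ∀ j, ((q * d : ℕ) : ℝ) • b j ∈ L)
    (hrep : ∀ a, gridClass b (q * d) L (rep a) = a) (s : ℝ) (tv : Fin m → V) :
    (((indepLaw m fun i => offsetLaw b q d L rep hSL hrep s (tv i)).bind fun cbar =>
        (PMF.uniformOfFintype (Fin m → (QuotientAddGroup.mk' (gridImage b (q * d) L)).ker)).map
          (Prod.mk cbar)).bind fun ch => PMF.pure (queryMatrix b q d L rep ch.1 ch.2)) =
      (indepLaw m fun i =>
        (((offsetLaw b q d L rep hSL hrep s (tv i)).bind fun a =>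
            (PMF.uniformOfFintype (QuotientAddGroup.mk' (gridImage b (q * d) L)).ker).map
              fun h : (QuotientAddGroup.mk' (gridImage b (q * d) L)).ker =>
                gridCoord b (q * d) (rep a) + (h : Fin n → ZMod (q * d))).map
          fun w j => (((w j).val / d : ℕ) : ZMod q))).map
        fun A => Matrix.of fun j i => A i j := by
  -- flatten the left-hand side
  rw [PMF.bind_bind]
  have hL : ∀ cbar : Fin m → (Fin n → ZMod (q * d)) ⧸ gridImage b (q * d) L,
      (((PMF.uniformOfFintype (Fin m → (QuotientAddGroup.mk' (gridImage b (q * d) L)).ker)).map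
          (Prod.mk cbar)).bind fun ch => PMF.pure (queryMatrix b q d L rep ch.1 ch.2)) =
        ((indepLaw m fun _ => PMF.uniformOfFintype (QuotientAddGroup.mk' (gridImage b (q * d) L)).ker).map
          fun hv i j => ((((gridCoord b (q * d) (rep (cbar i)) +
            (hv i : Fin n → ZMod (q * d))) j).val / d : ℕ) : ZMod q)).map
          fun A => Matrix.of fun j i => A i j := by
    intro cbar
    rw [PMF.bind_map, indepLaw_uniformOfFintype, PMF.map_comp]
    rfl
  simp_rw [hL]
  rw [← PMF.map_bind]
  congr 1
  rw [indepLaw_bind_indepLaw_map m _ _ (fun i a (h : (QuotientAddGroup.mk' (gridImage b (q * d) L)).ker) j =>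
    ((((gridCoord b (q * d) (rep a) + (h : Fin n → ZMod (q * d))) j).val / d : ℕ) : ZMod q))]
  refine congrArg (indepLaw m) (funext fun i => ?_)
  rw [PMF.map_bind]
  refine congrArg (offsetLaw b q d L rep hSL hrep s (tv i)).bind (funext fun a => ?_)
  rw [PMF.map_comp]
  rfl

/-- **Eq. (13) with Lemma 5.8 (i) for the idealised experiment**: for `0 < ε`, `0 < s`,
`η_ε(L) ≤ s` and `L ⊆ L'`, the query `A` is within `m · 2ε/(1+ε)` of uniform on `ℤ_q^{n×m}`.
[cite: MicciancioRegev2007, Thm. 5.9 (proof, eq. (13) and the following paragraph, p. 23)] -/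
theorem tvDist_query_le (hSL : ∀ j, ((q * d : ℕ) : ℝ) • b j ∈ L)
    (hrep : ∀ a, gridClass b (q * d) L (rep a) = a)
    (hLL' : L ≤ span ℤ (Set.range b)) {ε s : ℝ} (hε : 0 < ε) (hs : 0 < s)
    (hηs : smoothingParameter L ε ≤ s) (tv : Fin m → V) :
    (((indepLaw m fun i => offsetLaw b q d L rep hSL hrep s (tv i)).bind fun cbar =>
        (PMF.uniformOfFintype (Fin m → (QuotientAddGroup.mk' (gridImage b (q * d) L)).ker)).map
          (Prod.mk cbar)).bind fun ch => PMF.pure (queryMatrix b q d L rep ch.1 ch.2)).tvDist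
        (PMF.uniformOfFintype (Matrix (Fin n) (Fin m) (ZMod q))) ≤ m * (2 * ε / (1 + ε)) := by
  rw [bind_pure_queryMatrix_eq]
  refine (tvDist_indepLaw_query_matrix_le (QuotientAddGroup.mk' (gridImage b (q * d) L))
    (fun a => gridCoord b (q * d) (rep a)) (mk'_gridCoord_rep b q d L rep hrep) m _).trans ?_
  calc ∑ i, (offsetLaw b q d L rep hSL hrep s (tv i)).tvDist (PMF.uniformOfFintype _)
      ≤ ∑ _i : Fin m, 2 * ε / (1 + ε) := Finset.sum_le_sum fun i _ =>
        tvDist_gridSample_fst_le hLL' (gridClass b (q * d) L) (gridClass_surjective b (q * d) L)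
          (gridClass_eq_zero_iff b (q * d) L hSL) rep hrep hε hs hηs (tv i)
    _ = m * (2 * ε / (1 + ε)) := by rw [Finset.sum_const, Finset.card_univ, Fintype.card_fin, nsmul_eq_mul]

/-! ### Support: the recorded query is the true query -/

omit [MeasurableSpace V] [BorelSpace V] [IsZLattice ℝ L] in
/-- On the support of the experiment the matrix component IS `queryMatrix` of the first stage.
[folklore] -/
theorem query_eq_of_mem_support (hSL : ∀ j, ((q * d : ℕ) : ℝ) • b j ∈ L)
    (hrep : ∀ a, gridClass b (q * d) L (rep a) = a)
    (O : Matrix (Fin n) (Fin m) (ZMod q) → PMF (Fin m → ℤ)) (s : ℝ)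
    (tv : Fin m → V) {ω} (hω : ω ∈ (experiment b q d L rep hSL hrep O s tv).support) :
    ω.1.2.1 = queryMatrix b q d L rep ω.1.1.1 ω.1.1.2 := by
  simp only [experiment, PMF.mem_support_bind_iff, PMF.support_map, Set.mem_image,
    PMF.support_pure, Set.mem_singleton_iff] at hω
  obtain ⟨ch, -, y, -, az, ⟨A, rfl, z, -, rfl⟩, rfl⟩ := hω
  rfl

/-- Complements for a `PMF`, real form: `Pr[Sᶜ] = 1 − Pr[S]`. [folklore] -/
theorem toReal_toOuterMeasure_compl {α : Type*} (p : PMF α) (S : Set α) :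
    (p.toOuterMeasure Sᶜ).toReal = 1 - (p.toOuterMeasure S).toReal := by
  have h : p.toOuterMeasure S + p.toOuterMeasure Sᶜ = 1 := by
    rw [PMF.toOuterMeasure_apply, PMF.toOuterMeasure_apply, ← ENNReal.tsum_add, ← p.tsum_coe]
    exact tsum_congr fun x => Set.indicator_self_add_compl_apply S p x
  have hS : p.toOuterMeasure S ≠ ∞ := PMF.toOuterMeasure_ne_top p S
  have hSc : p.toOuterMeasure Sᶜ ≠ ∞ := PMF.toOuterMeasure_ne_top p Sᶜ
  have := congrArg ENNReal.toReal h
  rw [ENNReal.toReal_add hS hSc, ENNReal.toReal_one] at this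
  linarith

/-! ### The conditional success given the first stage and a good oracle answer (`≥ 1/3`) -/

omit [MeasurableSpace V] [BorelSpace V] [IsZLattice ℝ L] [NeZero q] [NeZero d] in
/-- The conditional law with the centres written `ĉᵢ + tᵢ` (the order used in `MRIncGDDSuccessPMF`).
[folklore] -/
theorem condLaw_eq (s : ℝ) (tv : Fin m → V) (cbar : Fin m → (Fin n → ZMod (q * d)) ⧸ gridImage b (q * d) L) :
    condLaw b q d L rep s tv cbar = indepLaw m fun i => discreteGaussian L s ((rep (cbar i) : V) + tv i) := by
  simp only [condLaw, add_comm]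

omit [MeasurableSpace V] [BorelSpace V] [IsZLattice ℝ L] [DiscreteTopology L] [FiniteDimensional ℝ V]
  [NeZero q] [NeZero d] in
/-- **`A z ≡ 0 (mod q)` for the true query gives the divisibility hypothesis of Lemma 5.8 (ii).**
[cite: MicciancioRegev2007, Lemma 5.8 (proof of the second property: "Az/q is an integer vector because Az = 0 mod q")] -/
theorem dvd_of_queryMatrix_mulVec_eq_zero
    (cbar : Fin m → (Fin n → ZMod (q * d)) ⧸ gridImage b (q * d) L)
    (hv : Fin m → (QuotientAddGroup.mk' (gridImage b (q * d) L)).ker) {z : Fin m → ℤ}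
    (hAz : (queryMatrix b q d L rep cbar hv).mulVec (fun i => (z i : ZMod q)) = 0) (j : Fin n) :
    (q : ℤ) ∣ ∑ i, z i *
      ((((gridCoord b (q * d) (rep (cbar i)) + (hv i : Fin n → ZMod (q * d))) j).val / d : ℕ) : ℤ) := by
  have h : ∑ i, ((((gridCoord b (q * d) (rep (cbar i)) + (hv i : Fin n → ZMod (q * d))) j).val / d : ℕ) :
      ZMod q) * (z i : ZMod q) = 0 := congrFun hAz j
  rw [← ZMod.intCast_zmod_eq_zero_iff_dvd, Int.cast_sum, ← h]
  exact Finset.sum_congr rfl fun i _ => by rw [Int.cast_mul, Int.cast_natCast, mul_comm]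

/-- **MR07 Thm. 5.9 — success probability `≥ 1/3` conditioned on the first stage and on a good
answer** (p. 23: "conditioned on any fixed values of `C`, `A` and `z` for which `H` is satisfied").
Fix the classes `c̄`, the lattice classes `h`, and a pair `(A, z)` with `A z ≡ 0 (mod q)`,
`‖z‖ ≤ β`, `z_{j₀} = α` (so `∑ zᵢtᵢ = −t`). If `A` is the true query, the output `s = x − Yz` lies in
`L` (Lemma 5.8 (ii)) and `‖s − t‖ ≤ n√m β σ/q + r` unless `‖(Y − (C+T))z‖ > r`, which has conditional
probability `≤ 2/3` (`MRIncGDDSuccessPMF`); if `A` is not the true query the implication defining the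
event is vacuous. Parameters: `0 < ε < 1`, `s = 2r/(β√n) ≥ 2η_ε(L)`, `‖sⱼ‖ ≤ σ`, and the side
condition `1/(2π) + ε/(1−ε) + (ε/(1−ε))² m ≤ 1/6`.
[cite: MicciancioRegev2007, Thm. 5.9 (proof, pp. 23–24)] -/
theorem cond_success_ge (hSL : ∀ j, ((q * d : ℕ) : ℝ) • b j ∈ L) {ε β r σ : ℝ} (hε : 0 < ε) (hε1 : ε < 1) (hβ : 0 < β) (hr : 0 < r)
    (hn : 1 ≤ finrank ℝ V)
    (hηs : 2 * smoothingParameter L ε ≤ 2 * r / (β * Real.sqrt (finrank ℝ V)))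
    (hσ : ∀ j, ‖((q * d : ℕ) : ℝ) • b j‖ ≤ σ) (tv : Fin m → V) (t : V) (j₀ : Fin m) (α : ℤ)
    (htv : ∀ z : Fin m → ℤ, z j₀ = α → ∑ i, (z i : ℝ) • tv i = -t)
    (hnum : 1 / (2 * π) + ε / (1 - ε) + (ε / (1 - ε)) ^ 2 * m ≤ 1 / 6)
    (ch : (Fin m → (Fin n → ZMod (q * d)) ⧸ gridImage b (q * d) L) ×
      (Fin m → (QuotientAddGroup.mk' (gridImage b (q * d) L)).ker))
    (az : Matrix (Fin n) (Fin m) (ZMod q) × (Fin m → ℤ))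
    (haz : az.1.mulVec (fun i => (az.2 i : ZMod q)) = 0 ∧ ∑ i, (az.2 i : ℝ) ^ 2 ≤ β ^ 2 ∧ az.2 j₀ = α) :
    (1 / 3 : ℝ) ≤ ((condLaw b q d L rep (2 * r / (β * Real.sqrt (finrank ℝ V))) tv ch.1).toOuterMeasure
        {y | az.1 = queryMatrix b q d L rep ch.1 ch.2 →
          (output b q d L rep ((ch, az), y) ∈ L ∧
            ‖output b q d L rep ((ch, az), y) - t‖ ≤ n * Real.sqrt m * β * σ / q + r)}).toReal := by
  obtain ⟨cbar, hv⟩ := ch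
  obtain ⟨A, z⟩ := az
  obtain ⟨hAz, hz, hzj⟩ := haz
  dsimp only at hAz hz hzj ⊢
  by_cases hA : A = queryMatrix b q d L rep cbar hv
  · -- the true query: Lemma 5.8 (ii)/(iii) and the conditional `2/3` bound
    subst hA
    set x : V := combineOutput b q d L rep cbar hv z with hx_def
    set bnd : ℝ := n * Real.sqrt m * β * σ / q with hbnd
    have hn' : 1 ≤ n := by simpa [Module.finrank_eq_card_basis b] using hn
    have hσ0 : 0 ≤ σ := (norm_nonneg _).trans (hσ ⟨0, hn'⟩)
    have hxL : x ∈ L := combine_mem_grid b L q d hSL (fun i => rep (cbar i))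
      (fun i => (QuotientAddGroup.ker_mk' (gridImage b (q * d) L)).le (hv i).2)
      (dvd_of_queryMatrix_mulVec_eq_zero b q d L rep cbar hv hAz)
    have hznorm : ‖intVecToEuclidean m z‖ ≤ β := by
      rw [norm_intVecToEuclidean]
      calc Real.sqrt (∑ j, (z j : ℝ) ^ 2) ≤ Real.sqrt (β ^ 2) := Real.sqrt_le_sqrt hz
        _ = β := Real.sqrt_sq hβ.le
    have hxC : ‖x - ∑ i, (z i : ℝ) • (rep (cbar i) : V)‖ ≤ bnd := by
      refine (norm_combine_sub_le_grid b q d (fun i => rep (cbar i))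
        (fun i => (hv i : Fin n → ZMod (q * d))) z hσ).trans ?_
      rw [hbnd]
      gcongr
    have hT := htv z hzj
    set P : PMF (Fin m → L) := indepLaw m fun i =>
      discreteGaussian L (2 * r / (β * Real.sqrt (finrank ℝ V))) ((rep (cbar i) : V) + tv i) with hP
    have hfail : (P.toOuterMeasure
        {y | bnd + r < ‖(x - ∑ i, (z i : ℝ) • ((y i : L) : V)) - t‖}).toReal ≤ 2 / 3 :=
      toReal_indepLaw_lt_norm_output_sub_le L hε hε1 hβ hr hn hηs (fun i => (rep (cbar i) : V)) tv
        hz hnum hxC hT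
    rw [condLaw_eq]
    -- the good event contains the complement of the failure event
    have hsub : {y : Fin m → L | bnd + r < ‖(x - ∑ i, (z i : ℝ) • ((y i : L) : V)) - t‖}ᶜ ⊆
        {y | queryMatrix b q d L rep cbar hv = queryMatrix b q d L rep cbar hv →
          (output b q d L rep (((cbar, hv), (queryMatrix b q d L rep cbar hv, z)), y) ∈ L ∧
            ‖output b q d L rep (((cbar, hv), (queryMatrix b q d L rep cbar hv, z)), y) - t‖ ≤
              n * Real.sqrt m * β * σ / q + r)} := by
      intro y hy _
      simp only [Set.mem_compl_iff, Set.mem_setOf_eq, not_lt] at hy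
      have hout : output b q d L rep (((cbar, hv), (queryMatrix b q d L rep cbar hv, z)), y) =
          x - ∑ i, (z i : ℝ) • ((y i : L) : V) := rfl
      rw [hout]
      refine ⟨L.sub_mem hxL (Submodule.sum_mem _ fun i _ => ?_), hy⟩
      rw [Int.cast_smul_eq_zsmul]
      exact L.smul_mem (z i) (y i).2
    calc (1 / 3 : ℝ) = 1 - 2 / 3 := by norm_num
      _ ≤ 1 - (P.toOuterMeasure {y | bnd + r < ‖(x - ∑ i, (z i : ℝ) • ((y i : L) : V)) - t‖}).toReal := by
          linarith
      _ = (P.toOuterMeasure {y | bnd + r < ‖(x - ∑ i, (z i : ℝ) • ((y i : L) : V)) - t‖}ᶜ).toReal :=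
          (toReal_toOuterMeasure_compl P _).symm
      _ ≤ _ := ENNReal.toReal_mono (PMF.toOuterMeasure_ne_top _ _)
          (P.toOuterMeasure_mono (Set.inter_subset_left.trans hsub))
  · -- not the true query: the event is everything
    have hall : {y : Fin m → L | A = queryMatrix b q d L rep cbar hv →
        (output b q d L rep (((cbar, hv), (A, z)), y) ∈ L ∧
          ‖output b q d L rep (((cbar, hv), (A, z)), y) - t‖ ≤ n * Real.sqrt m * β * σ / q + r)} =
        Set.univ := Set.eq_univ_of_forall fun y h => (hA h).elim
    rw [hall, (PMF.toOuterMeasure_apply_eq_one_iff _ _).2 (Set.subset_univ _), ENNReal.toReal_one]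
    norm_num

/-! ### The success probability of the idealised reduction -/

/-- **MR07 Thm. 5.9 for the idealised reduction on the fine grid (fixed guess).** Let `L` be a
full-rank lattice with `sⱼ = M bⱼ ∈ L ⊆ L' = span_ℤ b` (`M = q·d`), representatives `rep` of the
offset classes, an arbitrary oracle kernel `O` on `ℤ_q^{n×m}`, shifts `tᵢ` with `∑ zᵢtᵢ = −t`
whenever `z_{j₀} = α`, `0 < ε < 1`, the Gaussian parameter `s = 2r/(β√n) ≥ 2η_ε(L)`, `‖sⱼ‖ ≤ σ`, and
the side condition `1/(2π) + ε/(1−ε) + (ε/(1−ε))² m ≤ 1/6`. Writing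
`δ = Pr_{A ∼ U(ℤ_q^{n×m}), z ∼ O(A)}[A z ≡ 0, ‖z‖ ≤ β, z_{j₀} = α]` (MR07's `δ_{j,α}`), the output
`s = x − Yz` of `experiment` satisfies
`Pr[s ∈ L ∧ ‖s − t‖ ≤ n√m β σ/q + r] ≥ (δ − m · 2ε/(1+ε))/3`
(print: "`H` holds with probability at least `δ_{j,α} − εm/2` … the success probability of the
reduction conditioned on `H` is at least `1/3`"; with `q ≥ g n√m β` and `σ = ‖S‖` the radius is
`‖S‖/g + r`, i.e. an `IncGDD_{γ,g}` solution for `r ≥ γ η_ε`, `γ = β√n`).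
[cite: MicciancioRegev2007, Thm. 5.9 (statement p. 22, proof pp. 22–24)] -/
theorem toReal_experiment_success_ge (hSL : ∀ j, ((q * d : ℕ) : ℝ) • b j ∈ L)
    (hrep : ∀ a, gridClass b (q * d) L (rep a) = a) (hLL' : L ≤ span ℤ (Set.range b))
    (O : Matrix (Fin n) (Fin m) (ZMod q) → PMF (Fin m → ℤ)) {ε β r σ : ℝ} (hε : 0 < ε) (hε1 : ε < 1)
    (hβ : 0 < β) (hr : 0 < r) (hn : 1 ≤ finrank ℝ V)
    (hηs : 2 * smoothingParameter L ε ≤ 2 * r / (β * Real.sqrt (finrank ℝ V)))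
    (hσ : ∀ j, ‖((q * d : ℕ) : ℝ) • b j‖ ≤ σ) (tv : Fin m → V) (t : V) (j₀ : Fin m) (α : ℤ)
    (htv : ∀ z : Fin m → ℤ, z j₀ = α → ∑ i, (z i : ℝ) • tv i = -t)
    (hnum : 1 / (2 * π) + ε / (1 - ε) + (ε / (1 - ε)) ^ 2 * m ≤ 1 / 6) :
    (1 / 3 : ℝ) *
        ((((PMF.uniformOfFintype (Matrix (Fin n) (Fin m) (ZMod q))).bind fun A =>
            (O A).map (Prod.mk A)).toOuterMeasure
            {az | az.1.mulVec (fun i => (az.2 i : ZMod q)) = 0 ∧ ∑ i, (az.2 i : ℝ) ^ 2 ≤ β ^ 2 ∧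
              az.2 j₀ = α}).toReal - m * (2 * ε / (1 + ε))) ≤
      ((experiment b q d L rep hSL hrep O (2 * r / (β * Real.sqrt (finrank ℝ V))) tv).toOuterMeasure
        {ω | output b q d L rep ω ∈ L ∧
          ‖output b q d L rep ω - t‖ ≤ n * Real.sqrt m * β * σ / q + r}).toReal := by
  set s : ℝ := 2 * r / (β * Real.sqrt (finrank ℝ V)) with hs_def
  have hsqrt : 0 < Real.sqrt (finrank ℝ V) := Real.sqrt_pos.2 (by exact_mod_cast hn)
  have hs : 0 < s := by rw [hs_def]; positivity
  have hηs' : smoothingParameter L ε ≤ s := by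
    have h0 := smoothingParameter_nonneg L ε
    rw [hs_def]; linarith
  -- the probability skeleton, with `θ = 1/3` from `cond_success_ge`
  have hskel := PMF.mul_sub_tvDist_le_toReal_experiment
    (((indepLaw m fun i => offsetLaw b q d L rep hSL hrep s (tv i)).bind fun cbar =>
      (PMF.uniformOfFintype (Fin m → (QuotientAddGroup.mk' (gridImage b (q * d) L)).ker)).map
        (Prod.mk cbar)))
    (fun ch => PMF.pure (queryMatrix b q d L rep ch.1 ch.2)) O
    (fun ch => condLaw b q d L rep s tv ch.1)
    (PMF.uniformOfFintype (Matrix (Fin n) (Fin m) (ZMod q)))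
    {az | az.1.mulVec (fun i => (az.2 i : ZMod q)) = 0 ∧ ∑ i, (az.2 i : ℝ) ^ 2 ≤ β ^ 2 ∧ az.2 j₀ = α}
    {ω | ω.1.2.1 = queryMatrix b q d L rep ω.1.1.1 ω.1.1.2 →
      (output b q d L rep ω ∈ L ∧ ‖output b q d L rep ω - t‖ ≤ n * Real.sqrt m * β * σ / q + r)}
    (θ := 1 / 3) (by norm_num)
    (fun ch az haz => cond_success_ge b q d L rep hSL hε hε1 hβ hr hn hηs hσ tv t j₀ α htv hnum ch az haz)
  -- the distance of the query from uniform
  have hΔ := tvDist_query_le b q d L rep hSL hrep hLL' hε hs hηs' tv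
  -- from the implication event to the success event, through the support
  have hmono : ((experiment b q d L rep hSL hrep O s tv).toOuterMeasure
      {ω | ω.1.2.1 = queryMatrix b q d L rep ω.1.1.1 ω.1.1.2 →
        (output b q d L rep ω ∈ L ∧ ‖output b q d L rep ω - t‖ ≤ n * Real.sqrt m * β * σ / q + r)}).toReal ≤
      ((experiment b q d L rep hSL hrep O s tv).toOuterMeasure
        {ω | output b q d L rep ω ∈ L ∧
          ‖output b q d L rep ω - t‖ ≤ n * Real.sqrt m * β * σ / q + r}).toReal :=
    ENNReal.toReal_mono (PMF.toOuterMeasure_ne_top _ _) (PMF.toOuterMeasure_mono _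
      fun ω hω => hω.1 (query_eq_of_mem_support b q d L rep hSL hrep O s tv hω.2))
  have hexp : (((indepLaw m fun i => offsetLaw b q d L rep hSL hrep s (tv i)).bind fun cbar =>
      (PMF.uniformOfFintype (Fin m → (QuotientAddGroup.mk' (gridImage b (q * d) L)).ker)).map
        (Prod.mk cbar)).bind fun ch => (condLaw b q d L rep s tv ch.1).bind fun y =>
          ((PMF.pure (queryMatrix b q d L rep ch.1 ch.2)).bind fun A => (O A).map (Prod.mk A)).map
            fun az => ((ch, az), y)) = experiment b q d L rep hSL hrep O s tv := rfl
  rw [hexp] at hskel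
  refine le_trans ?_ (hskel.trans hmono)
  exact mul_le_mul_of_nonneg_left (sub_le_sub_left hΔ _) (by norm_num)

/-! ### The experiment in sampling order (for the machine correspondence) -/

omit [MeasurableSpace V] [BorelSpace V] [IsZLattice ℝ L] in
/-- **Running the sampling procedure `m` times = classes first, then the conditional product**
(Lemma 5.7, second claim, for all runs at once): the product over `i` of the joint laws of
`(c̄ᵢ, yᵢ) = gridSample(rᵢ)`, `rᵢ ∼ D_{L',s,tᵢ}`, is `(⨂ᵢ offsetLaw) ≫= (c̄ ↦ condLaw c̄)`, zipped.
[cite: MicciancioRegev2007, Lemma 5.7 (second claim) with Thm. 5.9 (proof, step 2)] -/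
theorem indepLaw_map_gridSample_eq (hSL : ∀ j, ((q * d : ℕ) : ℝ) • b j ∈ L)
    (hrep : ∀ a, gridClass b (q * d) L (rep a) = a) (hLL' : L ≤ span ℤ (Set.range b)) {s : ℝ}
    (hs : 0 < s) (tv : Fin m → V) :
    (indepLaw m fun i => (discreteGaussian (span ℤ (Set.range b)) s (tv i)).map
        (gridSample (gridClass b (q * d) L) (gridClass_eq_zero_iff b (q * d) L hSL) rep hrep)) =
      (indepLaw m fun i => offsetLaw b q d L rep hSL hrep s (tv i)).bind fun cbar =>
        (condLaw b q d L rep s tv cbar).map fun y i => (cbar i, y i) := by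
  have hfac : ∀ i, (discreteGaussian (span ℤ (Set.range b)) s (tv i)).map
      (gridSample (gridClass b (q * d) L) (gridClass_eq_zero_iff b (q * d) L hSL) rep hrep) =
      (offsetLaw b q d L rep hSL hrep s (tv i)).bind fun a =>
        (discreteGaussian L s (tv i + (rep a : V))).map (Prod.mk a) := by
    intro i
    rw [map_gridSample_eq_bind hLL' _ _ rep hrep hs (tv i)]
    congr 1
    rw [offsetLaw, PMF.map_comp]
    rfl
  simp_rw [hfac]
  exact indepLaw_bind_map_prodMk m _ (fun i a => discreteGaussian L s (tv i + (rep a : V)))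

omit [MeasurableSpace V] [BorelSpace V] [IsZLattice ℝ L] in
/-- **The idealised experiment in sampling order.** Sampling the `m` pairs `(c̄ᵢ, yᵢ)` by the
sampling procedure, then the `m` uniform lattice classes `hᵢ`, forming the query and calling the
oracle — the order in which a machine runs the reduction — yields exactly `experiment` (classes and
lattice classes first, then `y` and `(A, z)` conditionally independently).
[cite: MicciancioRegev2007, Thm. 5.9 (proof, steps 2–4 and Figure 2)] -/
theorem experiment_eq_samplingOrder (hSL : ∀ j, ((q * d : ℕ) : ℝ) • b j ∈ L)
    (hrep : ∀ a, gridClass b (q * d) L (rep a) = a) (hLL' : L ≤ span ℤ (Set.range b))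
    (O : Matrix (Fin n) (Fin m) (ZMod q) → PMF (Fin m → ℤ)) {s : ℝ} (hs : 0 < s) (tv : Fin m → V) :
    ((indepLaw m fun i => (discreteGaussian (span ℤ (Set.range b)) s (tv i)).map
        (gridSample (gridClass b (q * d) L) (gridClass_eq_zero_iff b (q * d) L hSL) rep hrep)).bind
      fun cy => (PMF.uniformOfFintype (Fin m → (QuotientAddGroup.mk' (gridImage b (q * d) L)).ker)).bind
        fun hv => (O (queryMatrix b q d L rep (fun i => (cy i).1) hv)).map fun z =>
          ((((fun i => (cy i).1), hv), (queryMatrix b q d L rep (fun i => (cy i).1) hv, z)),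
            fun i => (cy i).2)) =
      experiment b q d L rep hSL hrep O s tv := by
  rw [indepLaw_map_gridSample_eq b q d L rep hSL hrep hLL' hs tv, PMF.bind_bind, experiment, PMF.bind_bind]
  refine congrArg (indepLaw m fun i => offsetLaw b q d L rep hSL hrep s (tv i)).bind (funext fun cbar => ?_)
  rw [PMF.bind_map, PMF.bind_map]
  -- both sides: `y` and `hv` independent given `cbar`; swap them on the left
  change ((condLaw b q d L rep s tv cbar).bind fun y =>
      (PMF.uniformOfFintype (Fin m → (QuotientAddGroup.mk' (gridImage b (q * d) L)).ker)).bind fun hv =>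
        (O (queryMatrix b q d L rep cbar hv)).map fun z =>
          (((cbar, hv), (queryMatrix b q d L rep cbar hv, z)), y)) =
    (PMF.uniformOfFintype (Fin m → (QuotientAddGroup.mk' (gridImage b (q * d) L)).ker)).bind fun hv =>
      (condLaw b q d L rep s tv cbar).bind fun y =>
        ((PMF.pure (queryMatrix b q d L rep cbar hv)).bind fun A => (O A).map (Prod.mk A)).map
          fun az => (((cbar, hv), az), y)
  rw [PMF.bind_comm]
  refine congrArg (PMF.uniformOfFintype _).bind (funext fun hv => ?_)
  refine congrArg (condLaw b q d L rep s tv cbar).bind (funext fun y => ?_)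
  rw [PMF.pure_bind, PMF.map_comp]
  rfl

end Idealised

end MicciancioRegev2007

end Literature.Algebra.EuclideanLattices

end
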